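import Summits.BirchSwinnertonDyer.BirchSwinnertonDyer.Theorems.PrintCf2RamifiedOffTYZGenusPeriodDescent
import HarnessLib

/-!
# C⁺ ON THE VISIBLE R2 ROWS ⟺ «`Z(lq)` not `2`-torsion ∧ `N_{H(i)/M}(x(z) − 2i) ∉ ⟨i⟩·ℍ′²`» — the exact-descent criterion WITHOUT the torsion
# hypothesis (crux stmt-BirchSwinnertonDyer-20509 `RamifiedOffTYZOfFacts`, line `offtyz-v7`, LEAD g29, cycle 30, part 2d)

HONEST FRAMING (cell `bsd-print-cf2`, route `PrintCf2`; `--supports stmt-BirchSwinnertonDyer-20509`; theorems only, `def`-free, no `sorry`).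
BSD is not proved by any of this; no class is closed by this file; item 23431 (C⁺) and crux 20509 stay OPEN.

Part 2c (`…GenusPeriodDescent`, p800776) proved the exact-descent identities `κ⁰_{ℍ′}(Z(d)) = [N₁]`, `κ⁺_{ℍ′}(Z(d)) = [N₀]` under «`Z(d)` not
`2`-torsion» and stated the R2 criterion under that hypothesis.  The norms `N₁ = N_{H/L} x(z)`, `N₀ = N_{H(i)/M}(x(z) − 2i) ∈ ℍ′_n` exist independently of
it (Galois descent in `M`, g26), and on a visible R2 row C⁺ FORCES `Z(lq)` non-torsion (g26's `levelTwo_iff_genusPeriod_not_twoDivisible_of_visible`).  So: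

* ★★★★ `levelTwo_iff_not_torsion_and_secondNorm_of_visible_R2_of_facts` — granted conjuncts 1, 2, 4, 5 of 𝔅_ram and `tyz_sevenBlockCMData`, on an
  R2 row `n = lq` (`ord L(E_n) = 1`, visible generator `X(h) ∉ 2ℚ^{×2}`) there are a display package `D` and, in it, `M ⊇ ℍ′_n`, the CM point
  `z_n = (x₀, y₀)`, `Φ` (`#Φ = g(n)`) and the norms `N₁, N₀ ∈ ℍ′_n` (`ι N₁ = ∏_{t∈Φ} t x₀`, `ι N₀ = ∏_{t∈Φ}(t x₀ − 2ι(i))`, both `≠ 0`) such that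
  **`[N₁] = 1` (THEOREM A) ∧ `ζ₈ ∉ ℍ′_n` ⟹ ( C⁺ at `lq`  ⟺  `2·Z(n) ≠ 0` ∧ neither `N₀` nor `N₀·i` is a square in `ℍ′_n` )** — no hypothesis on `Z(n)`.

References: [cite: TianYuanZhang2017, §1, §3.1 (p0011 L53–L66), §3.2 (p0012 L8–L9), Lemma 3.16, Lemma 3.18, Thm. 3.5, Thm. 1.2]; [cite: SilvermanAEC2009, Thm. X.1.1, Prop. X.1.4];
[cite: NeukirchSchmidtWingberg2008, §1.5]; [cite: BurungaleFlach2024, Thm 1.1 / Cor. 3]; [cite: Darmon2004, Thm. 3.22]; tree: p790023, p799839, p800776, p789339.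
-/

noncomputable section

open scoped Classical

open WeierstrassCurve WeierstrassCurve.Affine WeierstrassCurve.Affine.Point
  Literature.NumberTheory.EllipticCurves Literature.NumberTheory.EllipticCurves.Rank1Residual
  Summit.BirchSwinnertonDyer.Rank1Residual
  Literature.NumberTheory.EllipticCurves.TianYuanZhang2017
  Literature.NumberTheory.EllipticCurves.TianYuanZhang2017.W2
  Summit.BirchSwinnertonDyer.PrintCf2.VisibleGenerator

set_option autoImplicit false

namespace Summit.BirchSwinnertonDyer.PrintCf2.GenusPeriodTraceNorm

variable {n : ℕ}

open Literature.NumberTheory.EllipticCurves.TianYuanZhang2017.GenusPointData (galPtOver)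

/-- **The norms exist without any hypothesis on `Z(d)`** (Galois descent in `M`, g26): for the data (S1)–(S3) of the seven-block display at `d` there are
`N₁, N₀ ∈ ℍ′_n`, both non-zero, with `ι N₁ = ∏_{t∈Φ} t x₀` and `ι N₀ = ∏_{t∈Φ}(t x₀ − 2ι(i))`; and IF `Z(d)` is not `2`-torsion the exact-descent identities
hold for THESE elements. [cite: TianYuanZhang2017, §3.1 (p0011 L53–L66)] [cite: SilvermanAEC2009, Thm. X.1.1, Prop. X.1.4] [cite: NeukirchSchmidtWingberg2008, §1.5] -/
theorem exists_norms_and_exactDescent (D : GenusPointData n) {d : ℕ} {M : Type} [Field M] [NumberField M] [IsGalois ℚ M] (ι : D.H →ₐ[ℚ] M)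
    {x₀ y₀ : M} (h₀ : (curveA.baseChange M).toAffine.Nonsingular x₀ y₀) (Φ : Finset (M ≃ₐ[ℚ] M))
    (hS1 : Point.map (W' := curveA) ι (D.Z d) = ∑ t ∈ Φ, galPtOver M t (.some x₀ y₀ h₀))
    (hS2 : ∀ t ∈ Φ, ¬ ((2 : ℕ) • galPtOver M t (.some x₀ y₀ h₀) = 0 ∨ (2 : ℕ) • galPtOver M t (.some x₀ y₀ h₀) = tauOne))
    (hS3 : ∀ g : M ≃ₐ[ℚ] M, D.TrivialOnLOver ι d g →
      ∃ π : Φ → Φ, Function.Bijective π ∧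
        ∀ t : Φ, galPtOver M g (galPtOver M (t : M ≃ₐ[ℚ] M) (.some x₀ y₀ h₀)) = galPtOver M (π t : M ≃ₐ[ℚ] M) (.some x₀ y₀ h₀)) :
    ∃ N₁ N₀ : D.H, ι N₁ = ∏ t ∈ Φ, (t : M ≃ₐ[ℚ] M) x₀ ∧ ι N₀ = ∏ t ∈ Φ, ((t : M ≃ₐ[ℚ] M) x₀ - 2 * ι D.im) ∧ N₁ ≠ 0 ∧ N₀ ≠ 0 ∧
      ((2 : ℕ) • D.Z d ≠ 0 →
        twoDescentComponent (curveA.baseChange D.H).toAffine 0 (2 * D.im) (-(2 * D.im)) (D.Z d) = sqClass N₁ ∧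
        twoDescentComponent (curveA.baseChange D.H).toAffine (2 * D.im) 0 (-(2 * D.im)) (D.Z d) = sqClass N₀) := by
  -- the two norms by Galois descent in M
  have himM : (ι D.im) ^ 2 = -1 := by rw [← map_pow, D.im_sq, map_neg, map_one]
  obtain ⟨N₀, hN₀, -⟩ := GenusPeriodNorm.exists_norm_in_H_twoDescentComponent_genusPeriod_eq D ι h₀ Φ hS1 hS2 hS3
  have hfixM : ∀ g : M ≃ₐ[ℚ] M, g ∈ IntermediateField.fixingSubgroup ι.fieldRange →
      g (∏ t ∈ Φ, ((t : M ≃ₐ[ℚ] M) x₀ - 0)) = ∏ t ∈ Φ, ((t : M ≃ₐ[ℚ] M) x₀ - 0) := fun g hg =>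
    GenusPeriodNorm.norm_fixed_of_trivialOnL D ι h₀ Φ hS3 g (GenusPeriodNorm.trivialOnLOver_of_mem_fixingSubgroup D ι d hg) 0 (_root_.map_zero g)
  obtain ⟨N₁, hN₁⟩ := GenusPeriodNorm.exists_eq_of_forall_fixing D ι hfixM
  simp only [sub_zero] at hN₁
  have hfac : ∀ t ∈ Φ, (t : M ≃ₐ[ℚ] M) x₀ - 2 * ι D.im ≠ 0 ∧ (t : M ≃ₐ[ℚ] M) x₀ ≠ 0 := by
    intro t ht
    have h2 : (2 : ℕ) • galPtOver M t (.some x₀ y₀ h₀) ≠ 0 := fun h0 => hS2 t ht (Or.inl h0)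
    rw [GenusPeriodNorm.galPtOver_some t h₀] at h2
    have hx := GenusPeriodNorm.X_ne_of_two_smul_ne_zero himM _ h2
    exact ⟨sub_ne_zero.mpr hx.1, hx.2.1⟩
  have hN0ne : N₀ ≠ 0 := by
    intro h0; rw [h0, _root_.map_zero] at hN₀
    exact (Finset.prod_ne_zero_iff.mpr fun t ht => (hfac t ht).1) hN₀.symm
  have hN1ne : N₁ ≠ 0 := by
    intro h0; rw [h0, _root_.map_zero] at hN₁
    exact (Finset.prod_ne_zero_iff.mpr fun t ht => (hfac t ht).2) hN₁.symm
  refine ⟨N₁, N₀, hN₁, hN₀, hN1ne, hN0ne, fun hZ2 => ?_⟩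
  obtain ⟨N₁', hN₁', -, hκ₁⟩ := twoDescentComponent_genusPeriod_eq_sqClass_norm_zero D ι h₀ Φ hS1 hS2 hS3 hZ2
  obtain ⟨N₀', hN₀', -, hκ₀⟩ := twoDescentComponent_genusPeriod_eq_sqClass_norm D ι h₀ Φ hS1 hS2 hS3 hZ2
  have e1 : N₁' = N₁ := ι.toRingHom.injective (hN₁'.trans hN₁.symm)
  have e0 : N₀' = N₀ := ι.toRingHom.injective (hN₀'.trans hN₀.symm)
  exact ⟨e1 ▸ hκ₁, e0 ▸ hκ₀⟩

/-- ★★★★ **C⁺ ON A VISIBLE R2 ROW ⟺ `Z(lq)` NOT `2`-TORSION ∧ THE SECOND NORM NOT IN `⟨i⟩·ℍ′²` — granted only THEOREM A (`[N₁] = 1`) and `ζ₈ ∉ ℍ′_n`.**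
Conjuncts 1, 2, 4, 5 of 𝔅_ram + `tyz_sevenBlockCMData`; primes `l ≡ 1`, `q ≡ 7 (mod 8)`, `n = lq`, `ord_{s=1} L(E_n, s) = 1`; a VISIBLE generator `h = (X, Y)`
of `A_n(ℚ)` modulo torsion (`X ∉ 2ℚ^{×2}`).  Then there is a display package `D` of `n` with, in it, `M ⊇ ℍ′_n`, the CM point `(x₀, y₀)`, `Φ` (`#Φ = g(n)`),
and the norms `N₁ = N_{H/L}(x(z_n))`, `N₀ = N_{H(i)/M}(x(z_n) − 2i) ∈ ℍ′_n` (both `≠ 0`) such that: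
**`[N₁] = 1 → [i] ≠ 1 → ( (∀ L, 𝓛(n)² = L² → 2 ∥ L) ⟺ (2·Z(n) ≠ 0 ∧ ¬(N₀ ∈ ℍ′² ∨ N₀·i ∈ ℍ′²)) )`.**
[cite: TianYuanZhang2017, §1, §3.1, §3.2, Thm. 3.5, Lemma 3.18, Thm. 1.2] [cite: BurungaleFlach2024, Thm 1.1 / Cor. 3] [cite: Darmon2004, Thm. 3.22]
[cite: SilvermanAEC2009, Thm. X.1.1, Prop. X.1.4] [cite: NeukirchSchmidtWingberg2008, §1.5] -/
theorem levelTwo_iff_not_torsion_and_secondNorm_of_visible_R2_of_facts (hGZK : rank_eq_analyticRank_of_analyticRank_le_one)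
    (hmod : WeierstrassCurve.hasEntireLFunction_rat) (hCM0 : bsdTriple_of_hasCM_of_L_one_ne_zero) (h12 : thm12_parity_of_scriptL')
    (hT : tyz_sevenBlockCMData)
    {l q : ℕ} (hl : l.Prime) (hq : q.Prime) (hl8 : l % 8 = 1) (hq8 : q % 8 = 7) (hn : n = l * q)
    (hr : (congruentNumberCurve n).analyticRank = 1)
    {X Y : ℚ} (h : (Atwo n).toAffine.Nonsingular X Y) (hX : ¬ ∃ s : ℚ, X = 2 * s ^ 2)
    (hgen : ∀ P : (Atwo n).toAffine.Point, ∃ m : ℤ, IsOfFinAddOrder (P - m • (Point.some X Y h : (Atwo n).toAffine.Point))) :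
    ∃ D : GenusPointData n, D.Printed ∧ D.CMPointCompositumPrinted ∧ D.Thm35AtBlocks ∧
      ∃ (M : Type) (_ : Field M) (_ : NumberField M) (_ : IsGalois ℚ M) (ι : D.H →ₐ[ℚ] M) (x₀ y₀ : M)
        (h₀ : (curveA.baseChange M).toAffine.Nonsingular x₀ y₀) (Φ : Finset (M ≃ₐ[ℚ] M)) (N₁ N₀ : D.H),
        Φ.card = gK n ∧
        Point.map (W' := curveA) ι (D.Z n) = ∑ t ∈ Φ, galPtOver M t (.some x₀ y₀ h₀) ∧
        ι N₁ = ∏ t ∈ Φ, (t : M ≃ₐ[ℚ] M) x₀ ∧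
        ι N₀ = ∏ t ∈ Φ, ((t : M ≃ₐ[ℚ] M) x₀ - 2 * ι D.im) ∧ N₁ ≠ 0 ∧ N₀ ≠ 0 ∧
        (sqClass N₁ = 1 → sqClass D.im ≠ 1 →
          ((∀ L : ℤ, IsScriptL n L → (2 : ℤ) ∣ L ∧ ¬ (4 : ℤ) ∣ L) ↔
            ((2 : ℕ) • D.Z n ≠ 0 ∧ ¬ ((∃ s : D.H, N₀ = s ^ 2) ∨ ∃ s : D.H, N₀ * D.im = s ^ 2)))) := by
  have hmod8 : n % 8 = 7 := by rw [hn, Nat.mul_mod, hl8, hq8]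
  have hsq : Squarefree n := by
    subst hn
    have hne : l ≠ q := fun h => by subst h; omega
    exact Nat.squarefree_mul_iff.mpr ⟨(Nat.coprime_primes hl hq).mpr hne, hl.squarefree, hq.squarefree⟩
  have hodd : Odd n := by
    rw [hn, Nat.odd_mul]; exact ⟨Nat.odd_iff.mpr (by omega), Nat.odd_iff.mpr (by omega)⟩
  obtain ⟨D, hPr, hC, hBl, hSeven⟩ := hT n hsq (Or.inr (Or.inr hmod8))
  obtain ⟨M, iF, iN, iG, ι, z, Φ, ⟨hS1, hcard⟩, hS2, hS3⟩ := hSeven n (Nat.mem_divisors_self n hsq.ne_zero) hmod8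
  have hΦ : Φ.Nonempty := Finset.card_pos.mp (by rw [hcard]; exact GenusPeriodNorm.gK_pos n)
  obtain ⟨t₀, ht₀⟩ := hΦ
  have hz : z ≠ 0 := by
    intro hz
    apply GenusPointData.galPtOver_ne_zero_of_not_cusp hS2 ht₀
    rw [hz, _root_.map_zero]
  rcases z with _ | ⟨x₀, y₀, h₀⟩
  · exact absurd rfl hz
  obtain ⟨N₁, N₀, hN₁, hN₀, hne₁, hne₀, hED⟩ := exists_norms_and_exactDescent D ι h₀ Φ hS1 hS2 hS3
  refine ⟨D, hPr, hC, hBl, M, iF, iN, iG, ι, x₀, y₀, h₀, Φ, N₁, N₀, hcard, hS1, hN₁, hN₀, hne₁, hne₀, fun hA hi8 => ?_⟩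
  have h318 : D.lemma318 := hPr.2.2.2.2.2.2.2.2.1
  by_cases hZ2 : (2 : ℕ) • D.Z n = 0
  · -- Z(lq) is 2-torsion: C⁺ fails by g26's visible branch (Z − 2·0 is torsion), and so does the right-hand side
    rw [GenusPeriodR2.levelTwo_iff_genusPeriod_not_twoDivisible_of_visible hGZK hmod hCM0 h12 hl hq hl8 hq8 hn hr D hPr hC hBl h hX hgen]
    have htors : ∃ y : APoint D.H, IsOfFinAddOrder (D.Z n - (2 : ℤ) • y) :=
      ⟨0, by rw [smul_zero, sub_zero]; exact isOfFinAddOrder_iff_nsmul_eq_zero.mpr ⟨2, two_pos, hZ2⟩⟩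
    constructor
    · exact fun hc => absurd htors hc
    · exact fun hc => absurd hZ2 hc.1
  · obtain ⟨hκ₁, hκ₀⟩ := hED hZ2
    rw [GenusPeriodExactDescent.levelTwo_iff_secondNorm_of_visible_R2 hGZK hmod hCM0 h12 hl hq hl8 hq8 hn hr D hPr hC hBl hi8 h hX hgen hne₀
      hκ₁ hκ₀ hA]
    exact ⟨fun hc => ⟨hZ2, hc⟩, fun hc => hc.2⟩

end Summit.BirchSwinnertonDyer.PrintCf2.GenusPeriodTraceNorm

end
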